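import Mathlib
import Summits.Ventures.HodgeRepro2.Tier7.Line3.Defs
import Summits.Ventures.HodgeRepro2.Tier7.Line1.FDConverse
import Summits.Ventures.HodgeRepro2.Tier7.Common.TwoTorus

/-!
# Tier 7 — LINE 1 / LINE 3 BRIDGE: `CommonIrred D → Line3.RtfConclusion D` on displayed data (`Line1/RtfBridge.lean`; t7-L1-p3)

Third prover product of t7-L1-p3 (item from t7-plan-1, STATUS l. 14809): the CONVERSE of plan-2's
`Common.commonIrred_of_TT : Line3.RtfConclusion D → Line1.CommonIrred D` (Common/TwoTorus.lean p661845), so that on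
data carrying the printed facts displayed as hypotheses the two residuals of the tier COINCIDE and both are the
conclusion in its common-vector form: `Line3.RtfConclusion D ↔ CommonIrred D ↔ ∃ g, L2 (fOmegaS g) (fOmegaSbar g) ≠ 0`
(`rtfConclusion_iff_commonIrred`, `rtfConclusion_iff_conclusion`).

THE DISPLAYED HYPOTHESES (each a printed fact about the real `X`, none a consequence of the frozen fields, none the
step): `OrthDistinct D` (distinct Hecke-irreducibles of `H^{2,0}` are `L²`-orthogonal — Liu 2021 App. D (D.1) with
multiplicity one, the tower hypothesis of Line1/CupProduct), `hfin` (every Hecke-irreducible subspace of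
`H^{1,0} ∧ H^{1,0}` is finite-dimensional — true at every finite level of the tower, FALSE of the full tower whose
constituents are the infinite-dimensional `π_f`: the statement is per datum and says so), and a Hecke-equivariant
projector `P : HX → HX` onto `H^{1,0} ∧ H^{1,0}` (`hPmem`, `hPid`, `hPact` — on the real `X` the Hodge projector
`H^*(X_∞, ℂ) → H^{2,0}`, Hecke-equivariant because the Hecke translates are holomorphic).

THE CONSTRUCTION (plan-1's sketch, l. 14809): from `CommonIrred D` take a Hecke-irreducible `W ≤ P_A ⊓ P_B`
(`commonIrred_iff_inf_ne_bot` + `exists_irred_le_of_stable`); `sw : Line3.SeesawData D` with `Rep := Unit`,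
`Θ := W` and `comp := proj_W ∘ P`, where `proj_W` is t7-L1-p5's `L²`-orthogonal projection `FD.projLin` onto the
finite-dimensional `W` (`comp_mem` = `projLin_mem`; `comp_act` = `projLin_equivariant` + `hPact`; `comp_preserves`:
a Hecke-stable `U ⊆ H^{2,0}` either contains `W` or is `L²`-orthogonal to it by the contrapositive of t7-L1-p1's
`le_of_L2_ne_zero`, and on the orthogonal complement the projection vanishes); the two non-vanishing clauses of
`RtfConclusion`: `comp` is the identity on `W ≠ ⊥` and `W ⊆ P_A = span (range fOmegaS)`, so `comp` cannot kill every
generator `fOmegaS g` (likewise for `B`). Nothing here produces a non-vanishing: the file converts one residual into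
the other on the displayed data. Imports: `Mathlib` + `Line3.Defs` + `Line1.FDConverse` + `Common.TwoTorus`.
Sorry-free; axioms of every theorem: propext / Classical.choice / Quot.sound. Paper note: HOME
proofs/t7/L1/RTFBRIDGE-p3.md.
§8(d): uses an L-value-free non-vanishing device: NO.
-/

namespace Summit.Ventures.HodgeRepro2.Tier7.Line1

open Summit.Ventures.HodgeRepro2.Tier7

noncomputable section

variable {K : Type} [Field K] [NumberField K] {E' : Type} [Field E'] [NumberField E']
  {V : Type} [AddCommGroup V] [Module E' V] {HX : Type} [Ring HX] [Algebra ℂ HX]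
  {G : Type} [Group G] [MulAction G HX] (D : PeriodDatum K E' V HX G)

/-! ## 1. The isotypic projection onto a finite-dimensional `W ⊆ H^{2,0}`, through a displayed projector `P` -/

section Proj

variable (W : Submodule ℂ HX) (hW : W ≤ D.S.H10 * D.S.H10) [FiniteDimensional ℂ W]
  (P : HX →ₗ[ℂ] HX) (hPmem : ∀ x, P x ∈ D.S.H10 * D.S.H10)

/-- `comp := proj_W ∘ P : HX → HX`, the `W`-isotypic projection of L3's interface, built from t7-L1-p5's
`L²`-orthogonal projection onto `W` and the displayed projector `P` onto `H^{1,0} ∧ H^{1,0}` -/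
def projComp : HX →ₗ[ℂ] HX :=
  (FD.projLin D.S W hW (D.S.H10 * D.S.H10) le_rfl).comp (P.codRestrict (D.S.H10 * D.S.H10) hPmem)

/-- (PROVED) unfolding -/
theorem projComp_apply (x : HX) :
    projComp D W hW P hPmem x = FD.projLin D.S W hW (D.S.H10 * D.S.H10) le_rfl ⟨P x, hPmem x⟩ := rfl

/-- (PROVED) `comp` lands in `W` -/
theorem projComp_mem (x : HX) : projComp D W hW P hPmem x ∈ W :=
  FD.projLin_mem D.S W hW _ le_rfl _

/-- (PROVED) `comp` is Hecke-equivariant (`projLin_equivariant` for the Hecke-stable `W` + `hPact`) -/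
theorem projComp_act (hWs : HeckeStable G W) (hPact : ∀ (g : G) x, P (g • x) = g • P x) (g : G) (x : HX) :
    projComp D W hW P hPmem (g • x) = g • projComp D W hW P hPmem x := by
  rw [projComp_apply, projComp_apply]
  have h := FD.projLin_equivariant D.S W hW hWs (D.S.H10 * D.S.H10) le_rfl (FD.H20_heckeStable D.S) g
    ⟨P x, hPmem x⟩
  have hx : (⟨P (g • x), hPmem (g • x)⟩ : ↥(D.S.H10 * D.S.H10)) =
      ⟨g • P x, FD.H20_heckeStable D.S g _ (hPmem x)⟩ := Subtype.ext (hPact g x)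
  rw [hx]
  exact h

/-- (PROVED) `comp` is the identity on `W` (`P` is the identity on `H^{2,0}`, the projection is the identity on
`W`) -/
theorem projComp_eq_self (hPid : ∀ x ∈ D.S.H10 * D.S.H10, P x = x) (x : HX) (hx : x ∈ W) :
    projComp D W hW P hPmem x = x := by
  rw [projComp_apply]
  show FD.projSub D.S W hW ⟨P x, hPmem x⟩ = x
  apply FD.projSub_eq
  · exact hx
  · show P x - x ∈ FD.orth D.S W
    rw [hPid x (hW hx), sub_self]
    exact Submodule.zero_mem _

/-- (PROVED) `comp` vanishes on a vector of `H^{2,0}` that is `L²`-orthogonal to `W` -/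
theorem projComp_eq_zero (hPid : ∀ x ∈ D.S.H10 * D.S.H10, P x = x) (x : HX) (hx : x ∈ D.S.H10 * D.S.H10)
    (horth : ∀ f ∈ W, D.S.L2 x f = 0) : projComp D W hW P hPmem x = 0 := by
  rw [projComp_apply]
  show FD.projSub D.S W hW ⟨P x, hPmem x⟩ = 0
  apply FD.projSub_eq
  · exact Submodule.zero_mem _
  · show P x - 0 ∈ FD.orth D.S W
    rw [sub_zero, hPid x hx, FD.mem_orth]
    exact ⟨hx, horth⟩

end Proj

/-! ## 2. From a common irreducible constituent to L3's `SeesawData` and `RtfConclusion` -/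

/-- **(PROVED) `CommonIrred D → Line3.RtfConclusion D`** on data with the displayed `OrthDistinct`,
finite-dimensional irreducibles and a Hecke-equivariant projector `P` onto `H^{1,0} ∧ H^{1,0}` — the converse of
`Common.commonIrred_of_TT`. -/
theorem rtfConclusion_of_commonIrred (ho : OrthDistinct D)
    (hfin : ∀ W : Submodule ℂ HX, HeckeIrred G W → W ≤ D.S.H10 * D.S.H10 → FiniteDimensional ℂ W)
    (P : HX →ₗ[ℂ] HX) (hPmem : ∀ x, P x ∈ D.S.H10 * D.S.H10)
    (hPid : ∀ x ∈ D.S.H10 * D.S.H10, P x = x) (hPact : ∀ (g : G) x, P (g • x) = g • P x)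
    (hc : CommonIrred D) : Line3.RtfConclusion D := by
  have hinf := (commonIrred_iff_inf_ne_bot D).mp hc
  obtain ⟨W, hWle, hW⟩ := exists_irred_le_of_stable D (inf_le_left.trans (prodModS_le D))
    (heckeStable_inf (prodModS_stable D) (prodModSbar_stable D)) hinf
  have hWH : W ≤ D.S.H10 * D.S.H10 := hWle.trans (inf_le_left.trans (prodModS_le D))
  haveI : FiniteDimensional ℂ W := hfin W hW hWH
  let comp : HX →ₗ[ℂ] HX := projComp D W hWH P hPmem
  let sw : Line3.SeesawData D :=
    { Rep := Unit
      Θ := fun _ => W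
      comp := fun _ => comp
      Θ_le := fun _ => hWH
      Θ_irred := fun _ _ => hW
      comp_mem := fun _ x => projComp_mem D W hWH P hPmem x
      comp_act := fun _ g x => projComp_act D W hWH P hPmem hW.2.1 hPact g x
      comp_preserves := fun _ U hU hUs x hx => by
        by_cases hWU : W ≤ U
        · exact hWU (projComp_mem D W hWH P hPmem x)
        · have horth : ∀ f ∈ W, D.S.L2 x f = 0 := by
            intro f hf
            by_contra hne
            exact hWU (le_of_L2_ne_zero D ho hW hWH hU hUs hx hf hne)
          show projComp D W hWH P hPmem x ∈ U
          rw [projComp_eq_zero D W hWH P hPmem hPid x (hU hx) horth]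
          exact Submodule.zero_mem _ }
  have hgen : ∀ F : (Fin 4 → G) → HX, W ≤ Submodule.span ℂ (Set.range F) →
      ∃ g : Fin 4 → G, comp (F g) ≠ 0 := by
    intro F hWF
    by_contra hall
    have hall' : ∀ g : Fin 4 → G, comp (F g) = 0 := fun g => by
      by_contra h
      exact hall ⟨g, h⟩
    have hker : Submodule.span ℂ (Set.range F) ≤ LinearMap.ker comp := by
      rw [Submodule.span_le]
      rintro _ ⟨g, rfl⟩
      exact LinearMap.mem_ker.mpr (hall' g)
    obtain ⟨w, hw, hw0⟩ := Submodule.exists_mem_ne_zero_of_ne_bot hW.1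
    have h1 : comp w = 0 := LinearMap.mem_ker.mp (hker (hWF hw))
    have h2 : comp w = w := projComp_eq_self D W hWH P hPmem hPid w hw
    exact hw0 (h2.symm.trans h1)
  exact ⟨sw, (), hgen D.fOmegaS (hWle.trans inf_le_left), hgen D.fOmegaSbar (hWle.trans inf_le_right)⟩

/-- (PROVED) on such data the two residuals of the tier COINCIDE: `Line3.RtfConclusion D ↔ CommonIrred D`
(⇒ is plan-2's `Common.commonIrred_of_rtfConclusion`) -/
theorem rtfConclusion_iff_commonIrred (ho : OrthDistinct D)
    (hfin : ∀ W : Submodule ℂ HX, HeckeIrred G W → W ≤ D.S.H10 * D.S.H10 → FiniteDimensional ℂ W)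
    (P : HX →ₗ[ℂ] HX) (hPmem : ∀ x, P x ∈ D.S.H10 * D.S.H10)
    (hPid : ∀ x ∈ D.S.H10 * D.S.H10, P x = x) (hPact : ∀ (g : G) x, P (g • x) = g • P x) :
    Line3.RtfConclusion D ↔ CommonIrred D :=
  ⟨Common.commonIrred_of_rtfConclusion D, rtfConclusion_of_commonIrred D ho hfin P hPmem hPid hPact⟩

/-- (PROVED) and both are the conclusion (P) for the datum in its common-vector form: ONE residual for the tier on
such data (`commonIrred_iff_conclusion_of_orth`, t7-L1-p5) -/
theorem rtfConclusion_iff_conclusion (ho : OrthDistinct D)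
    (hfin : ∀ W : Submodule ℂ HX, HeckeIrred G W → W ≤ D.S.H10 * D.S.H10 → FiniteDimensional ℂ W)
    (P : HX →ₗ[ℂ] HX) (hPmem : ∀ x, P x ∈ D.S.H10 * D.S.H10)
    (hPid : ∀ x ∈ D.S.H10 * D.S.H10, P x = x) (hPact : ∀ (g : G) x, P (g • x) = g • P x) :
    Line3.RtfConclusion D ↔ ∃ g : Fin 4 → G, D.S.L2 (D.fOmegaS g) (D.fOmegaSbar g) ≠ 0 :=
  (rtfConclusion_iff_commonIrred D ho hfin P hPmem hPid hPact).trans (commonIrred_iff_conclusion_of_orth D ho)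

/-- (PROVED) the finite-dimensional special case: `FiniteDimensional ℂ (H10 * H10)` gives both `OrthDistinct`
(`orthDistinct_of_finiteDimensional`, t7-L1-p5) and the finite-dimensionality of every irreducible -/
theorem rtfConclusion_of_commonIrred_of_finiteDimensional (hfd : FiniteDimensional ℂ (D.S.H10 * D.S.H10))
    (P : HX →ₗ[ℂ] HX) (hPmem : ∀ x, P x ∈ D.S.H10 * D.S.H10)
    (hPid : ∀ x ∈ D.S.H10 * D.S.H10, P x = x) (hPact : ∀ (g : G) x, P (g • x) = g • P x)
    (hc : CommonIrred D) : Line3.RtfConclusion D :=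
  rtfConclusion_of_commonIrred D (orthDistinct_of_finiteDimensional D hfd)
    (fun _ _ hWle => Submodule.finiteDimensional_of_le hWle) P hPmem hPid hPact hc

end

end Summit.Ventures.HodgeRepro2.Tier7.Line1
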